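import Summits.CriticalPhenomena.PercolationContinuityZ3.Theorems.PercAnnulusCrossingNoiseStability
import Summits.CriticalPhenomena.PercolationContinuityZ3.Theorems.PercAnnulusCrossingOSSSAnnulus
import HarnessLib

/-!
# RSW3 lane (lead, gen 20): NOISE SENSITIVITY OF CROSSINGS, V — set-to-set crossings explored from a RANDOM SEPARATING SEED SET:
# low-level Fourier weights, squared influences and the noise correlation of `𝟙{X ↔ B}` against the mixed revealment

builds on p205010 (kernel theorem, internal audit signed; external expert review pending) — NOT used in this file (abstract; every finite
edge-labelled graph, every bias vector in `[0,1]^E`).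

Cell `prim-rsw3` (LANE 3), lead seat, gen 20.  Support file (`--supports stmt-CriticalPhenomena-4575`); no definitions, no named facts,
no sorries.  Setting of gen 19's `variance_le_sum_revealment_mul_pivCross` (`…OSSSAnnulus` §1): finite edge-labelled graph `edge : W → W →
Option E` (symmetric, unique endpoints), biases `p ∈ [0,1]^E`, source set `X`, target set `B`, crossing indicator `gcross edge X B`;
here a finite FAMILY of seed sets `Z_s` (`s ∈ σ`), each separating `X` from `B` (every open `X–B` path meets `Z_s`), mixed with
probability weights `q_s`; `δ ≥ 0` bounds the mixed revealment: `Σ_s q_s·(P(a ↔ Z_s) + P(b ↔ Z_s)) ≤ δ` for every edge `e = ab`.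
The randomized algorithm "pick `s ~ q`, explore the clusters of `Z_s`" (`SeedExploration.strategy`) computes `𝟙{X ↔ B}` with revealment `≤ δ`,
so parts III–IV apply:

* §1 `seedLabel_eq_gcross_of_halt` (halting correctness of the 0/1 label "a seed vertex is joined to both `X` and `B`" under separation),
  `tree_seed_eval`, `tree_seed_reduced`, `sum_revealment_seed_le` (mixed revealment `≤ δ`).
* §2 **`level_weight_gcross_le`** — `Σ_{|S|=k} 𝟙̂{X↔B}(S)² ≤ k·δ·P(X ↔ B)` (p-biased characters written out), every `k ≥ 1`;
  **`sum_bias_mul_pivCross_sq_le`** — THE SQUARED INFLUENCES: `Σ_e p_e(1−p_e)·P(e pivotal for {X↔B})² ≤ δ·P(X ↔ B)` (level one);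
  **`noise_gcross_sub_sq_le`** — THE NOISE CORRELATION: for `0 ≤ ε ≤ 1` and every `m`,
  `0 ≤ E[𝟙{X↔B}(ω)·𝟙{X↔B}(ω^ε)] − P(X↔B)² ≤ m²·δ·P(X↔B) + (1−ε)^{m+1}·P(X↔B)(1 − P(X↔B))`.

References: O. Schramm, J. Steif, Ann. of Math. 171 (2010) Thm 1.8, §4 (the algorithm exploring from a random intermediate line);
H. Duminil-Copin, A. Raoufi, V. Tassion, Ann. of Math. 189 (2019) §3 Lemma 3.2 (exploring the clusters of a seed sphere; revealment
`≤ P(a ↔ Z) + P(b ↔ Z)`); V. Dewan, S. Muirhead, PTRF (2022) Lemma 2.9 (hyperplane/sphere explorations determine crossing events);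
I. Benjamini, G. Kalai, O. Schramm, Publ. IHÉS 90 (1999) Thm 1.3 (`Σ_e I_e² → 0`).
-/

noncomputable section

namespace Summit.CriticalPhenomena.PercolationContinuityZ3.Theorems.Crossing.Spectral

open Finset Function
open Literature.Probability.Percolation
open Literature.Probability.ODonnellSaksSchrammServedio2005
open Literature.Probability.ODonnellSaksSchrammServedio2005.Strategy
open Literature.Probability.Percolation.GhostExploration Literature.Probability.Percolation.SeedExploration

variable {W E : Type*} {edge : W → W → Option E}

/-! ## §1 The seed explorations compute `𝟙{X ↔ B}` with small mixed revealment -/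

open Classical in
/-- **HALTING CORRECTNESS UNDER SEPARATION**: if every open path from `X` to `B` meets `Z` (a seed vertex joined to both ends), then at a
halting state of the exploration of the clusters of `Z` consistent with the input, the label "some seed vertex is joined by queried-open edges to
a vertex of `X` and to a vertex of `B`" equals `𝟙{X ↔ B}` (gen 19's argument, as a lemma).
[cite: DuminilCopinRaoufiTassion2019, §3 proof of Lemma 3.2 (the exploration of the clusters of ∂Λ_k determines 𝟙_{0↔∂Λ_n})]
[cite: DewanMuirhead2022, §2 proof of Lemma 2.9] -/
theorem seedLabel_eq_gcross_of_halt (hsymm : ∀ a b, edge a b = edge b a) {Z X B : Set W}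
    (hsep : ∀ (y : E → Bool) (a b : W), a ∈ X → b ∈ B → YReach edge y a b → ∃ u ∈ Z, YReach edge y u a ∧ YReach edge y u b)
    (σ' : E → Option Bool) (x : E → Bool) (hc : Consistent σ' x) (hh : strategy edge Z σ' = none) :
    (if ∃ u ∈ Z, (∃ a ∈ X, SReach edge σ' u a) ∧ ∃ b ∈ B, SReach edge σ' u b then (1 : ℝ) else 0) = gcross edge X B x := by
  unfold SeedExploration.strategy at hh
  split_ifs at hh with h
  simp only [not_exists, not_and] at h
  have h'' : ∀ e, σ' e = none → ∀ a b, edge a b = some e → ¬Active edge Z σ' a := fun e he a b hab => h e he a b hab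
  have key : (∃ u ∈ Z, (∃ a ∈ X, SReach edge σ' u a) ∧ ∃ b ∈ B, SReach edge σ' u b) ↔ SConn edge X B x := by
    constructor
    · rintro ⟨u, _, ⟨a, ha, hua⟩, b, hb, hub⟩
      refine ⟨a, ha, b, hb, ?_⟩
      have h1 : YReach edge x a u := yReach_symm hsymm (yReach_of_sReach hc hua)
      have h2 : YReach edge x u b := yReach_of_sReach hc hub
      unfold YReach at h1 h2 ⊢
      exact h1.trans h2
    · rintro ⟨a, ha, b, hb, hab⟩
      obtain ⟨u, hu, hua, hub⟩ := hsep x a b ha hb hab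
      exact ⟨u, hu, ⟨a, ha, sReach_of_yReach_of_noPending hc h'' hu hua⟩, b, hb, sReach_of_yReach_of_noPending hc h'' hu hub⟩
  unfold gcross
  by_cases hA : ∃ u ∈ Z, (∃ a ∈ X, SReach edge σ' u a) ∧ ∃ b ∈ B, SReach edge σ' u b
  · rw [if_pos hA, if_pos (key.mp hA)]
  · rw [if_neg hA, if_neg (fun hG => hA (key.mpr hG))]

variable [Fintype E] [DecidableEq E]

open Classical in
/-- The decision tree of the seed exploration with the 0/1 labels computes `𝟙{X ↔ B}` (under separation).
[cite: DuminilCopinRaoufiTassion2019, §3 proof of Lemma 3.2 (T determines f)] -/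
theorem tree_seed_eval (hsymm : ∀ a b, edge a b = edge b a) {Z X B : Set W}
    (hsep : ∀ (y : E → Bool) (a b : W), a ∈ X → b ∈ B → YReach edge y a b → ∃ u ∈ Z, YReach edge y u a ∧ YReach edge y u b)
    (x : E → Bool) :
    (tree (strategy edge Z) (fun σ' => if ∃ u ∈ Z, (∃ a ∈ X, SReach edge σ' u a) ∧ ∃ b ∈ B, SReach edge σ' u b then (1 : ℝ) else 0)).eval x
      = gcross edge X B x :=
  eval_tree_eq (strategy_legal edge Z) (fun σ' x hc hh => seedLabel_eq_gcross_of_halt hsymm hsep σ' x hc hh) x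

/-- The decision tree of a seed exploration is reduced (legality: no edge is queried twice).
[cite: OdonnellEtAl2005, §3.2 proof of Thm 3.1 (no variable queried twice)] -/
theorem tree_seed_reduced (Z : Set W) (Lab : (E → Option Bool) → ℝ) : (tree (strategy edge Z) Lab).Reduced := by
  unfold Strategy.tree
  exact reduced_build (strategy_legal edge Z) Lab _ _

open Classical in
/-- **MIXED REVEALMENT OF THE SEED EXPLORATIONS**: if `Σ_s q_s (P(a ↔ Z_s) + P(b ↔ Z_s)) ≤ δ` for every edge `e = ab` (and `δ ≥ 0`), then every
label `e` is queried with mixed probability `Σ_s q_s P_p(e ∈ J_s) ≤ δ`.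
[cite: DuminilCopinRaoufiTassion2019, §3 proof of Lemma 3.2 (δ_e(T) ≤ μ[u ↔ ∂Λ_k] + μ[v ↔ ∂Λ_k])] [cite: SchrammSteif2010, §4 (revealment of the algorithm started from a uniform line)] -/
theorem sum_revealment_seed_le (hends : ∀ e a b a' b', edge a b = some e → edge a' b' = some e → a' = a ∨ a' = b)
    (p : E → ℝ) (h0 : ∀ e, 0 ≤ p e) (h1 : ∀ e, p e ≤ 1) {σ : Type*} [Fintype σ] (Z : σ → Set W) (q : σ → ℝ) (hq0 : ∀ s, 0 ≤ q s)
    (Lab : σ → (E → Option Bool) → ℝ) {δ : ℝ} (hδ0 : 0 ≤ δ)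
    (hδ : ∀ e a b, edge a b = some e → ∑ s, q s * (seedProb edge p (Z s) a + seedProb edge p (Z s) b) ≤ δ) (e : E) :
    ∑ s, q s * ∑ x : E → Bool, wt p x * (if e ∈ (tree (strategy edge (Z s)) (Lab s)).queried x then (1 : ℝ) else 0) ≤ δ := by
  by_cases hex : ∃ a b, edge a b = some e
  · obtain ⟨a₀, b₀, hab⟩ := hex
    refine le_trans (Finset.sum_le_sum fun s _ => mul_le_mul_of_nonneg_left ?_ (hq0 s)) (hδ e a₀ b₀ hab)
    have h := revealment_le h0 h1 (strategy edge (Z s)) (Lab s) e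
      (fun x => SeedConn edge (Z s) x a₀ ∨ SeedConn edge (Z s) x b₀) (fun σ' x hc hq => by
        obtain ⟨a, b, hab', hg'⟩ := seedConn_of_query hc hq
        rcases hends e a₀ b₀ a b hab hab' with rfl | rfl
        · exact Or.inl hg'
        · exact Or.inr hg')
    refine le_trans h ?_
    unfold seedProb
    rw [← Finset.sum_add_distrib]
    refine Finset.sum_le_sum fun x _ => ?_
    rw [← mul_add]
    refine mul_le_mul_of_nonneg_left ?_ (wt_nonneg h0 h1 x)
    by_cases ha : SeedConn edge (Z s) x a₀ <;> by_cases hb : SeedConn edge (Z s) x b₀ <;> simp [ha, hb]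
  · push Not at hex
    have hz : ∀ s, ∑ x : E → Bool, wt p x * (if e ∈ (tree (strategy edge (Z s)) (Lab s)).queried x then (1 : ℝ) else 0) ≤ 0 := by
      intro s
      have h := revealment_le h0 h1 (strategy edge (Z s)) (Lab s) e (fun _ => False) (fun σ' x hc hq => by
        obtain ⟨a, b, hab, _⟩ := seedConn_of_query hc hq
        exact hex a b hab)
      simpa [Strategy.revealment] using h
    exact le_trans (Finset.sum_nonpos fun s _ => mul_nonpos_of_nonneg_of_nonpos (hq0 s) (hz s)) hδ0

/-! ## §2 Spectrum, squared influences and noise correlation of `𝟙{X ↔ B}` -/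

section Crossing

variable (hsymm : ∀ a b, edge a b = edge b a) (hends : ∀ e a b a' b', edge a b = some e → edge a' b' = some e → a' = a ∨ a' = b)
  (p : E → ℝ) (h0 : ∀ e, 0 ≤ p e) (h1 : ∀ e, p e ≤ 1) {X B : Set W} {σ : Type*} [Fintype σ] (Z : σ → Set W)
  (hsep : ∀ s (y : E → Bool) (a b : W), a ∈ X → b ∈ B → YReach edge y a b → ∃ u ∈ Z s, YReach edge y u a ∧ YReach edge y u b)
  (q : σ → ℝ) (hq0 : ∀ s, 0 ≤ q s) (hq1 : ∑ s, q s = 1) {δ : ℝ} (hδ0 : 0 ≤ δ)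
  (hδ : ∀ e a b, edge a b = some e → ∑ s, q s * (seedProb edge p (Z s) a + seedProb edge p (Z s) b) ≤ δ)

include hsymm hends h0 h1 hsep hq0 hq1 hδ0 hδ in
open Classical in
/-- **THE LOW-LEVEL SPECTRUM OF A CROSSING EVENT** (Schramm–Steif for the mixed seed exploration), every `k ≥ 1`:
`Σ_{|S|=k} 𝟙̂{X↔B}(S)² ≤ k·δ·P(X ↔ B)`, with the p-biased characters `Π_{e∈S} (𝟙[x_e] − p_e)/√(p_e(1−p_e))`.
[cite: SchrammSteif2010, Thm 1.8] [cite: DuminilCopinRaoufiTassion2019, §3 Lemma 3.2 (the seed explorations and their revealment)] -/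
theorem level_weight_gcross_le {k : ℕ} (hk : 1 ≤ k) :
    ∑ S ∈ (Finset.univ : Finset E).powersetCard k,
        (∑ x : E → Bool, wt p x * (gcross edge X B x * ∏ e ∈ S, (((if x e then (1 : ℝ) else 0) - p e) / Real.sqrt (p e * (1 - p e))))) ^ 2
      ≤ k * δ * ∑ x : E → Bool, wt p x * gcross edge X B x := by
  have hsq : ∀ x, gcross edge X B x * gcross edge X B x = gcross edge X B x := by
    intro x; rcases gcross_mem edge X B x with h | h <;> simp [h]
  have h := level_weight_le_revealment p h0 h1 (r := fun e b => ((if b then (1 : ℝ) else 0) - p e) / Real.sqrt (p e * (1 - p e)))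
    (pbiased_H1 p) (pbiased_H2 p h0 h1) (gcross edge X B) q hq0 hq1
    (fun s => tree (strategy edge (Z s)) (fun σ' => if ∃ u ∈ Z s, (∃ a ∈ X, SReach edge σ' u a) ∧ ∃ b ∈ B, SReach edge σ' u b then (1 : ℝ) else 0))
    (fun s => tree_seed_reduced (Z s) _) (fun s x => tree_seed_eval hsymm (hsep s) x) hk hδ0
    (sum_revealment_seed_le hends p h0 h1 Z q hq0 _ hδ0 hδ)
  simp only [hsq] at h
  exact h

include hsymm hends h0 h1 hsep hq0 hq1 hδ0 hδ in
open Classical in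
/-- **THE SQUARED INFLUENCES OF A CROSSING EVENT** (level one): `Σ_e p_e(1−p_e)·P(e pivotal for {X ↔ B})² ≤ δ·P(X ↔ B)` — the ℓ²-norm of
the influence vector is controlled by the revealment, whatever its ℓ¹-norm `E[N_piv]` (compare BKS's criterion `Σ_e I_e² → 0`).
[cite: SchrammSteif2010, Thm 1.8 (k = 1)] [cite: BenjaminiKalaiSchramm1999, Thm 1.3 (II(f) = Σ_k I_k(f)²)] -/
theorem sum_bias_mul_pivCross_sq_le :
    ∑ e, p e * (1 - p e) * (pivCross edge p X B e) ^ 2 ≤ δ * ∑ x : E → Bool, wt p x * gcross edge X B x := by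
  have h := level_weight_gcross_le hsymm hends p h0 h1 Z hsep q hq0 hq1 hδ0 hδ (le_refl 1)
  rw [Nat.cast_one, one_mul] at h
  refine le_trans (le_of_eq ?_) h
  -- level one = singletons; `f̂({e}) = √(p_e(1−p_e))·pivCross e`
  rw [Finset.powersetCard_one, Finset.sum_map]
  refine Finset.sum_congr rfl fun e _ => ?_
  simp only [Function.Embedding.coeFn_mk, Finset.prod_singleton]
  have hctr : ∑ x : E → Bool, wt p x * (gcross edge X B x * (((if x e then (1 : ℝ) else 0) - p e) / Real.sqrt (p e * (1 - p e))))
      = (p e * (1 - p e) * pivCross edge p X B e) / Real.sqrt (p e * (1 - p e)) := by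
    rw [← sum_wt_gcross_mul_ctr p X B e, Finset.sum_div]
    refine Finset.sum_congr rfl fun x _ => ?_
    simp only [ctr]
    ring
  rw [hctr]
  by_cases hnd : 0 < p e ∧ p e < 1
  · have hpos : 0 < p e * (1 - p e) := by nlinarith
    rw [div_pow, Real.sq_sqrt hpos.le]
    field_simp
  · have hz : p e * (1 - p e) = 0 := by
      rcases not_and_or.1 hnd with h' | h'
      · have : p e = 0 := le_antisymm (not_lt.1 h') (h0 e); rw [this]; ring
      · have : p e = 1 := le_antisymm (h1 e) (not_lt.1 h'); rw [this]; ring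
    rw [hz]; simp

include hsymm hends h0 h1 hsep hq0 hq1 hδ0 hδ in
open Classical in
/-- **THE NOISE CORRELATION OF A CROSSING EVENT** against the mixed revealment of separating seed explorations: for `0 ≤ ε ≤ 1` and every `m`,
**`0 ≤ E[𝟙{X↔B}(ω)·𝟙{X↔B}(ω^ε)] − P(X↔B)² ≤ m²·δ·P(X↔B) + (1−ε)^{m+1}·(P(X↔B) − P(X↔B)²)`**, `ω^ε` = each edge independently resampled
from its bias with probability `ε`. [cite: SchrammSteif2010, Thm 1.8, Cor 1.9] [cite: GarbanSteif2014, Ch. VIII Prop VIII.3]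
[cite: BenjaminiKalaiSchramm1999, §1 (1.2)] -/
theorem noise_gcross_sub_sq_le {ε : ℝ} (hε0 : 0 ≤ ε) (hε1 : ε ≤ 1) (m : ℕ) :
    0 ≤ (∑ x : E → Bool, ∑ y : E → Bool, ∑ n : E → Bool, wt p x * wt p y * wt (fun _ => ε) n
          * (gcross edge X B x * gcross edge X B (fun e => if n e = true then y e else x e)))
        - (∑ x : E → Bool, wt p x * gcross edge X B x) ^ 2 ∧
      (∑ x : E → Bool, ∑ y : E → Bool, ∑ n : E → Bool, wt p x * wt p y * wt (fun _ => ε) n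
          * (gcross edge X B x * gcross edge X B (fun e => if n e = true then y e else x e)))
        - (∑ x : E → Bool, wt p x * gcross edge X B x) ^ 2
        ≤ (m : ℝ) ^ 2 * δ * (∑ x : E → Bool, wt p x * gcross edge X B x)
          + (1 - ε) ^ (m + 1) * ((∑ x : E → Bool, wt p x * gcross edge X B x) - (∑ x : E → Bool, wt p x * gcross edge X B x) ^ 2) := by
  have hsq : ∀ x, gcross edge X B x * gcross edge X B x = gcross edge X B x := by
    intro x; rcases gcross_mem edge X B x with h | h <;> simp [h]
  have h := noise_correlation_sub_sq_le_of_revealment p h0 h1 (gcross edge X B) q hq0 hq1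
    (fun s => tree (strategy edge (Z s)) (fun σ' => if ∃ u ∈ Z s, (∃ a ∈ X, SReach edge σ' u a) ∧ ∃ b ∈ B, SReach edge σ' u b then (1 : ℝ) else 0))
    (fun s => tree_seed_reduced (Z s) _) (fun s x => tree_seed_eval hsymm (hsep s) x) hδ0
    (sum_revealment_seed_le hends p h0 h1 Z q hq0 _ hδ0 hδ) hε0 hε1 m
  simp only [hsq] at h
  exact h

end Crossing

end Summit.CriticalPhenomena.PercolationContinuityZ3.Theorems.Crossing.Spectral

end
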